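import Summits.QuantumFields.BalabanUV.T4Continuum.Support.ShellMeasureRootCompositionSU2

/-!
# `T4Continuum.ShellMeasureBlockWiring` — SM-L1 ∕ SM-L3 WIRING at a live level: END-II's classifier binder `hAN` and
# graded-word binder `hGW` from PER-BOND data of the block, with the cell's `Plaq` ∕ `PBond` indexing
# (cell `pub-balaban`, sub-cell `t4`, spine estimate NE7c (node U5b); ROUND-2 crew seat `t4-ne7c-formalise-leaf-07`,
# row S4 of `t4/b2b-balaban-t4-ne7c-p1/LEAVES-NE7c-P1.md` under `t4/T4-NE7c-TRIGGER.json` c1–c6; ADDITIVE — imports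
# `ShellMeasureRootCompositionSU2` (p207698; hence `ShellMeasureLevelAssembly` p206468) only; 0 sorry, 0 citations)

HONEST FRAMING.  Finite four-torus programme, rung (B)+1 only — NOT infinite volume, NOT a mass gap, NOT the Clay
problem, NOT summit progress; (B), `BetaPertHyp`, (B^μ) not consumed.  NE7c = `T4IndicatorShell.ShellWeightBound` is
NOT PRINTED in [Bałaban 1983–89] and NOT PROVED; (M1) for Bałaban's inductively defined effective measures is NOT PRINTED
(GAPS G-ne7cp1-1) and asserted by nobody.  This file is BOOKKEEPING («NE7c ⇐ the named binders», trigger c3): it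
REPACKAGES the two analytic binders of `ShellMeasureLevelAssembly.slotAntiConcentration_of_levelData` ∕ END-II
`ShellMeasureRootCompositionSU2.slotAC_realized_su2_of_levelData` — SM-L1 `hAN` (one analyticity–boundedness witness per
classifier PLAQUETTE), SM-L3 `hGW` (one graded sectioned word per weight PLAQUETTE) — as binders PER BOND OF THE BLOCK, the
TYPE in which the located input is printed (B11 = [Balaban1985Variational] Prop. 9 p. 309 with (19)–(21), (172)–(173): the
localized minimiser's BOND variables are analytic and bounded on a complex sup-norm domain — GAPS G-ne7cp1-8a ∕ -14; the
residuals (i) radius, (ii) bound on the complex domain, (iii) k-uniformity are row S5's locator business, NOT decided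
here).  NO `def … : Prop` is minted for SM-L1 ∕ SM-L3 (trigger c2): the per-bond data stay HYPOTHESES of theorems; nothing
is instantiated at any live level; no `[cite:]` tag.  HONEST DEPENDENCY (cell): continuum YM on T⁴ ⇐ BetaPertH ∧ nine
spine estimates (0/9 proved); BetaPertH ⇐ (D1) ∧ (D4) ∧ CAP+tail; G-an2-4 gates asym, D1 and NE2/3/4.

THE PER-BOND BINDERS (per exterior section and window point `x`, along the complexified contraction `w ↦ w•x`): ONE family
of bond functions `X x : bonds → (ℂ → A)` («the block's bond variable `b` at `w•x` is `exp (X x b w)`») with, for every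
bond `b` of the block: (an) `X x b` complex differentiable on `‖w‖ < R`, `‖X x b w‖ ≤ a_b` there — SM-L1's pair `(R, a_b)`;
(fl) `X x b 0 = 0` (flat chart centre; classifier side); (sk) on `0 ≤ c ≤ 1`: `τ (X x b c) = 0`, `‖exp (±X x b c)‖ ≤ 1`
(skew-Hermitian TYPE; weight side) — plus FROZEN exterior letters `ext b o` (`o` = orientation), `‖ext b o‖ ≤ 1`,
`‖ext b o − 1‖ ≤ d_b`.  A plaquette reads its four ORIENTED boundary bonds `plaqOBonds p` — the bonds and inversions of
`Setup.GaugeField.plaqHol` (`plaqHol_eq_prod_plaqOBonds`) — as the factors `bondFactor`.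

WHAT IS PROVED ([folklore] bookkeeping).  §1 (generic bond index): `classifierWitness_of_orientedBondData` —
(an)+(fl) ⇒ the witness of `hAN` for the word of signed exponentials, `H = e^{ℓa} − 1` (`classifierWitness_of_bondData`);
`weightWord_of_orientedBondData` (with `bondMLetter_good`, `sSum_lSum_/mdFro_/mwordEval_map_bondMLetter`) — (an)+(sk)
on the moving bonds, contraction bounds on the frozen ones ⇒ the graded word of `hGW` with `s = Σ_{moving} a_b`,
`L = Σ_{moving} 3a_b/(R−1)` (`good_moving_of_bondData`), `d ≤ Σ_{frozen} d_b`.  §2 (the cell's indexing): `plaqOBonds`,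
`plaqHol_eq_prod_plaqOBonds`; `hAN_of_blockBondData`, `hGW_of_blockBondData` — END-II's two binders LITERALLY in their
registered shape (`ι = κ = Plaq P j`) from per-bond binders over the block's bonds, constants `R, a_b, d_b` free of
`x`/`V`: «one analyticity–boundedness pair per bond of the block, uniform».  §3 `slotAC_realized_su2_of_blockBondData`:
END-II with `hAN`/`hGW` REPLACED by the per-bond binders (consumer: road P1's END-I
`ShellMeasureRootComposition.shellWeightBound_of_slotAC`, binder `hac` at a live level; trigger c6), constant
`2(n + β Σ_{p∈P_w} L̄_p(d̄_p + 4 s̄_p) + B_𝓔)/(1−δ)` with the per-plaquette sums above and `H = e^{4ā} − 1` in (SM).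

WHAT THIS DOES NOT DO.  No bond datum is instantiated at any `j ≥ 1` (that IS the wall SM-L1 — located, NOT displayed
as numbers); SM-L2 ∕ L4 ∕ L5 ∕ L6 ∕ L7 ∕ L8 untouched; NE7c NOT proved; 0/9 spine.
-/

noncomputable section
open NormedSpace Set Function MeasureTheory Metric

namespace Summit.QuantumFields.BalabanUV.T4Continuum.ShellMeasureBlockWiring

open scoped ENNReal
open Literature.MathematicalPhysics.QuantumFieldTheory.Balaban1983to89
open GaugeField (GaugeInvariant)
open T4ShellMeasure (SlotAntiConcentration)
open T4CubeChartGnomonic (SU2)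
open T4CubeChartExp (expWindowDensity expFibreChart)
open T4ShellMeasureDet (blockLaw)
open T4TreeGaugeFixing (NoClosedLoop fixTo)
open ShellMeasureWilsonWords (wordExp)
open ShellMeasureWilsonTrace (TraceData)
open ShellMeasureWilsonMoving (MLetter mwordEval mdFro sSum lSum)
open ShellMeasureLevelAssembly (classifier weight classifierWitness_of_bondData good_moving_of_bondData)
open ShellMeasureRootCompositionSU2 (slotAC_realized_su2_of_levelData)

/-! ## §1 Oriented letters from per-bond data (generic bond index) -/

section Generic

variable {A : Type*} [NormedRing A] [NormedAlgebra ℂ A] [CompleteSpace A]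
variable {𝔟 : Type*}

/-- the orientation sign: a reversed bond contributes `−X`. [folklore] -/
def osgn (o : Bool) (y : A) : A := if o then -y else y

omit [NormedAlgebra ℂ A] [CompleteSpace A] in
/-- `‖±y‖ = ‖y‖`. [folklore] -/
@[simp] theorem norm_osgn (o : Bool) (y : A) : ‖osgn o y‖ = ‖y‖ := by cases o <;> simp [osgn, norm_neg]

omit [NormedAlgebra ℂ A] [CompleteSpace A] in
/-- `±0 = 0`. [folklore] -/
@[simp] theorem osgn_zero (o : Bool) : osgn o (0 : A) = 0 := by cases o <;> simp [osgn]

omit [CompleteSpace A] in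
/-- `w ↦ ±X(w)` is complex differentiable where `X` is. [folklore] -/
theorem differentiableOn_osgn {X : ℂ → A} {s : Set ℂ} (h : DifferentiableOn ℂ X s) (o : Bool) :
    DifferentiableOn ℂ (fun w => osgn o (X w)) s := by
  cases o
  exacts [h.congr fun w _ => by simp [osgn], h.neg.congr fun w _ => by simp [osgn]]

omit [CompleteSpace A] in
/-- `τ(±y) = 0` when `τ y = 0`. [folklore] -/
theorem τ_osgn (T : TraceData A) (o : Bool) {y : A} (h : T.τ y = 0) : T.τ (osgn o y) = 0 := by
  cases o <;> simp [osgn, T.map_neg, h]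

omit [NormedAlgebra ℂ A] [CompleteSpace A] in
/-- `‖exp (±y)‖ ≤ 1` when both `‖exp y‖ ≤ 1` and `‖exp (−y)‖ ≤ 1`. [folklore] -/
theorem norm_exp_osgn_le (o : Bool) {y : A} (hp : ‖exp y‖ ≤ 1) (hm : ‖exp (-y)‖ ≤ 1) :
    ‖exp (osgn o y)‖ ≤ 1 := by
  cases o
  exacts [by simpa only [osgn, Bool.false_eq_true, ↓reduceIte] using hp, by simpa only [osgn, ↓reduceIte] using hm]

/-- **CLASSIFIER SIDE.**  Oriented bond list `obs` with (an)+(fl) on its bonds (`X b` complex differentiable on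
`‖w‖ < R`, `‖X b‖ ≤ a` there, `X b 0 = 0`) and a holonomy along the real ray equal to the word of the SIGNED
exponentials ⇒ the witness of `hAN`: `‖f‖ ≤ e^{ℓa} − 1` (`ℓ` = length), `f 0 = 0`, `f c = hol c − 1`. [folklore] -/
theorem classifierWitness_of_orientedBondData (obs : List (𝔟 × Bool)) (X : 𝔟 → ℂ → A) {R a : ℝ} {hol : ℝ → A}
    (hX : ∀ bo ∈ obs, DifferentiableOn ℂ (X bo.1) (ball 0 R) ∧ (∀ w ∈ ball (0 : ℂ) R, ‖X bo.1 w‖ ≤ a) ∧ X bo.1 0 = 0)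
    (hhol : ∀ c : ℝ, 0 ≤ c → c ≤ 1 → hol c = (obs.map fun bo => exp (osgn bo.2 (X bo.1 c))).prod) :
    ∃ f : ℂ → A, DifferentiableOn ℂ f (ball 0 R) ∧
      (∀ w ∈ ball (0 : ℂ) R, ‖f w‖ ≤ Real.exp (obs.length * a) - 1) ∧ f 0 = 0 ∧
      ∀ c : ℝ, 0 ≤ c → c ≤ 1 → f (c : ℂ) = hol c - 1 := by
  set Xs : List (ℂ → A) := obs.map fun bo w => osgn bo.2 (X bo.1 w) with hXs
  have hX' : ∀ Y ∈ Xs, DifferentiableOn ℂ Y (ball 0 R) := fun Y hY => by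
    obtain ⟨bo, hbo, rfl⟩ := List.mem_map.1 hY
    exact differentiableOn_osgn (hX bo hbo).1 _
  have ha' : ∀ Y ∈ Xs, ∀ w ∈ ball (0 : ℂ) R, ‖Y w‖ ≤ a := fun Y hY w hw => by
    obtain ⟨bo, hbo, rfl⟩ := List.mem_map.1 hY
    simpa only [norm_osgn] using (hX bo hbo).2.1 w hw
  have h0' : ∀ Y ∈ Xs, Y 0 = 0 := fun Y hY => by
    obtain ⟨bo, hbo, rfl⟩ := List.mem_map.1 hY
    simp only [(hX bo hbo).2.2, osgn_zero]
  have hhol' : ∀ c : ℝ, 0 ≤ c → c ≤ 1 → hol c = wordExp (Xs.map fun Y => Y (c : ℂ)) := fun c hc0 hc1 => by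
    rw [hhol c hc0 hc1, hXs]
    simp only [wordExp, List.map_map, Function.comp_def]
  simpa only [hXs, List.length_map] using classifierWitness_of_bondData hX' ha' h0' hhol'

variable [DecidableEq 𝔟]

/-- THE FACTOR of the oriented bond `(b, o)` at contraction `c`: `exp (±X b c)` for a MOVING bond `b ∈ Λ` of the
block, the frozen exterior letter `ext b o` otherwise. [folklore] -/
def bondFactor (Λ : Finset 𝔟) (X : 𝔟 → ℂ → A) (ext : 𝔟 → Bool → A) (c : ℝ) (bo : 𝔟 × Bool) : A :=
  if bo.1 ∈ Λ then exp (osgn bo.2 (X bo.1 c)) else ext bo.1 bo.2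

/-- THE GRADED LETTER of the oriented bond `(b, o)`: moving `c ↦ ±X b c` with size `a b` and Lipschitz constant
`L b` for `b ∈ Λ`, frozen `ext b o` with `(0, 0)` otherwise. [folklore] -/
def bondMLetter (Λ : Finset 𝔟) (X : 𝔟 → ℂ → A) (ext : 𝔟 → Bool → A) (a L : 𝔟 → ℝ) (bo : 𝔟 × Bool) :
    MLetter A × ℝ × ℝ :=
  if bo.1 ∈ Λ then (MLetter.moving fun c : ℝ => osgn bo.2 (X bo.1 c), a bo.1, L bo.1)
  else (MLetter.frozen (ext bo.1 bo.2), 0, 0)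

/-- the MOVING size of an oriented bond list: `Σ_{(b,o), b ∈ Λ} a b`. [folklore] -/
def movingSize (Λ : Finset 𝔟) (a : 𝔟 → ℝ) (obs : List (𝔟 × Bool)) : ℝ :=
  (obs.map fun bo => if bo.1 ∈ Λ then a bo.1 else 0).sum

/-- the FROZEN size of an oriented bond list: `Σ_{(b,o), b ∉ Λ} d b`. [folklore] -/
def frozenSize (Λ : Finset 𝔟) (d : 𝔟 → ℝ) (obs : List (𝔟 × Bool)) : ℝ :=
  (obs.map fun bo => if bo.1 ∈ Λ then 0 else d bo.1).sum

/-- sizes of nonnegative data are nonnegative. [folklore] -/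
theorem sizes_nonneg (Λ : Finset 𝔟) {a d : 𝔟 → ℝ} (ha : ∀ b, 0 ≤ a b) (hd : ∀ b, 0 ≤ d b) (obs : List (𝔟 × Bool)) :
    0 ≤ movingSize Λ a obs ∧ 0 ≤ frozenSize Λ d obs := by
  constructor <;> refine List.sum_nonneg fun r hr => ?_ <;> obtain ⟨bo, -, rfl⟩ := List.mem_map.1 hr <;>
    by_cases h : bo.1 ∈ Λ <;> simp [h, ha, hd]

/-- **ONE GRADED LETTER IS ADMISSIBLE**: moving bond (`b ∈ Λ`) — (an) with bound `a b` and (sk) ⇒ `Good τ (a b)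
(3·a b/(R−1))` for either orientation (`good_moving_of_bondData`); frozen bond — `‖ext b o‖ ≤ 1`. [folklore] -/
theorem bondMLetter_good (T : TraceData A) {R : ℝ} (hR : 1 < R) (Λ : Finset 𝔟) (X : 𝔟 → ℂ → A)
    (ext : 𝔟 → Bool → A) (a : 𝔟 → ℝ) {bo : 𝔟 × Bool} (hfro : bo.1 ∉ Λ → ‖ext bo.1 bo.2‖ ≤ 1)
    (hmov : bo.1 ∈ Λ → DifferentiableOn ℂ (X bo.1) (ball 0 R) ∧ (∀ w ∈ ball (0 : ℂ) R, ‖X bo.1 w‖ ≤ a bo.1) ∧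
      ∀ c : ℝ, 0 ≤ c → c ≤ 1 → T.τ (X bo.1 c) = 0 ∧ ‖exp (X bo.1 c)‖ ≤ 1 ∧ ‖exp (-(X bo.1 c))‖ ≤ 1) :
    (bondMLetter Λ X ext a (fun b => 3 * a b / (R - 1)) bo).1.Good T.τ
      (bondMLetter Λ X ext a (fun b => 3 * a b / (R - 1)) bo).2.1
      (bondMLetter Λ X ext a (fun b => 3 * a b / (R - 1)) bo).2.2 := by
  unfold bondMLetter
  by_cases hb : bo.1 ∈ Λ
  · simp only [hb, ↓reduceIte]
    obtain ⟨hdiff, hbd, hsk⟩ := hmov hb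
    have h := good_moving_of_bondData T (𝓧 := fun w => osgn bo.2 (X bo.1 w)) (a := a bo.1) hR
      (differentiableOn_osgn hdiff _) (fun w hw => by rw [norm_osgn]; exact hbd w hw)
      (fun c hc0 hc1 => τ_osgn T _ (hsk c hc0 hc1).1)
      (fun c hc0 hc1 => norm_exp_osgn_le _ (hsk c hc0 hc1).2.1 (hsk c hc0 hc1).2.2)
    simpa only [mul_one] using h
  · simp only [hb, ↓reduceIte]
    exact ⟨hfro hb, le_rfl, le_rfl⟩

omit [NormedAlgebra ℂ A] [CompleteSpace A] in
/-- the graded word's size and Lipschitz sum are the moving sizes of `a` and `L`. [folklore] -/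
theorem sSum_lSum_map_bondMLetter (Λ : Finset 𝔟) (X : 𝔟 → ℂ → A) (ext : 𝔟 → Bool → A) (a L : 𝔟 → ℝ) :
    ∀ obs : List (𝔟 × Bool), sSum (obs.map (bondMLetter Λ X ext a L)) = movingSize Λ a obs ∧
      lSum (obs.map (bondMLetter Λ X ext a L)) = movingSize Λ L obs
  | [] => by simp [movingSize]
  | bo :: obs => by
    obtain ⟨ihs, ihl⟩ := sSum_lSum_map_bondMLetter Λ X ext a L obs
    simp only [movingSize] at ihs ihl
    simp only [movingSize, List.map_cons, List.sum_cons, ShellMeasureWilsonMoving.sSum_cons,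
      ShellMeasureWilsonMoving.lSum_cons, ihs, ihl]
    unfold bondMLetter
    by_cases h : bo.1 ∈ Λ <;> simp [h]

omit [NormedAlgebra ℂ A] [CompleteSpace A] in
/-- the graded word's frozen deviation is bounded by the frozen size of the deviation bounds. [folklore] -/
theorem mdFro_map_bondMLetter_le (Λ : Finset 𝔟) (X : 𝔟 → ℂ → A) (ext : 𝔟 → Bool → A) (a L d : 𝔟 → ℝ) :
    ∀ obs : List (𝔟 × Bool), (∀ bo ∈ obs, bo.1 ∉ Λ → ‖ext bo.1 bo.2 - 1‖ ≤ d bo.1) →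
      mdFro ((obs.map (bondMLetter Λ X ext a L)).map Prod.fst) ≤ frozenSize Λ d obs
  | [], _ => by simp [frozenSize]
  | bo :: obs, hd => by
    have ih := mdFro_map_bondMLetter_le Λ X ext a L d obs fun bo' h' => hd bo' (List.mem_cons_of_mem _ h')
    simp only [frozenSize] at ih
    simp only [frozenSize, List.map_cons, List.sum_cons, ShellMeasureWilsonMoving.mdFro_cons]
    refine add_le_add ?_ ih
    unfold bondMLetter
    by_cases h : bo.1 ∈ Λ
    · simp [h, MLetter.dev]
    · simpa only [h, ↓reduceIte, MLetter.dev] using hd bo (by simp) h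

omit [NormedAlgebra ℂ A] [CompleteSpace A] in
/-- the graded word evaluates, at every contraction `c`, to the product of the bond factors. [folklore] -/
theorem mwordEval_map_bondMLetter (Λ : Finset 𝔟) (X : 𝔟 → ℂ → A) (ext : 𝔟 → Bool → A) (a L : 𝔟 → ℝ) (c : ℝ) :
    ∀ obs : List (𝔟 × Bool),
      mwordEval c ((obs.map (bondMLetter Λ X ext a L)).map Prod.fst) = (obs.map (bondFactor Λ X ext c)).prod
  | [] => by simp
  | bo :: obs => by
    have ih := mwordEval_map_bondMLetter Λ X ext a L c obs
    simp only [List.map_cons, List.prod_cons, ShellMeasureWilsonMoving.mwordEval_cons]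
    rw [ih]
    unfold bondMLetter bondFactor
    by_cases h : bo.1 ∈ Λ <;> simp [h, MLetter.eval]

/-- **WEIGHT SIDE.**  Oriented bond list `obs` with (an)+(sk) on its moving bonds (`b ∈ Λ`), contraction and
deviation bounds on its frozen ones, word function along the real ray = product of the bond factors ⇒ the graded word
of `hGW`: admissible, `s ≤ Σ_{moving} a_b`, `L ≤ Σ_{moving} 3a_b/(R−1)`, `d ≤ Σ_{frozen} d_b`. [folklore] -/
theorem weightWord_of_orientedBondData (T : TraceData A) {R : ℝ} (hR : 1 < R) (Λ : Finset 𝔟) (X : 𝔟 → ℂ → A)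
    (ext : 𝔟 → Bool → A) (a d : 𝔟 → ℝ) (obs : List (𝔟 × Bool)) {G : ℝ → A}
    (hmov : ∀ bo ∈ obs, bo.1 ∈ Λ → DifferentiableOn ℂ (X bo.1) (ball 0 R) ∧ (∀ w ∈ ball (0 : ℂ) R, ‖X bo.1 w‖ ≤ a bo.1) ∧
      ∀ c : ℝ, 0 ≤ c → c ≤ 1 → T.τ (X bo.1 c) = 0 ∧ ‖exp (X bo.1 c)‖ ≤ 1 ∧ ‖exp (-(X bo.1 c))‖ ≤ 1)
    (hfro : ∀ bo ∈ obs, bo.1 ∉ Λ → ‖ext bo.1 bo.2‖ ≤ 1 ∧ ‖ext bo.1 bo.2 - 1‖ ≤ d bo.1)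
    (hG : ∀ c : ℝ, 0 ≤ c → c ≤ 1 → G c = (obs.map (bondFactor Λ X ext c)).prod) :
    ∃ gw : List (MLetter A × ℝ × ℝ), (∀ y ∈ gw, y.1.Good T.τ y.2.1 y.2.2) ∧
      sSum gw ≤ movingSize Λ a obs ∧ lSum gw ≤ movingSize Λ (fun b => 3 * a b / (R - 1)) obs ∧
      mdFro (gw.map Prod.fst) ≤ frozenSize Λ d obs ∧
      ∀ c : ℝ, 0 ≤ c → c ≤ 1 → mwordEval c (gw.map Prod.fst) = G c := by
  refine ⟨obs.map (bondMLetter Λ X ext a fun b => 3 * a b / (R - 1)), fun y hy => ?_,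
    (sSum_lSum_map_bondMLetter Λ X ext a _ obs).1.le, (sSum_lSum_map_bondMLetter Λ X ext a _ obs).2.le,
    mdFro_map_bondMLetter_le Λ X ext a _ d obs fun bo hbo h => (hfro bo hbo h).2, fun c hc0 hc1 => ?_⟩
  · obtain ⟨bo, hbo, rfl⟩ := List.mem_map.1 hy
    exact bondMLetter_good T hR Λ X ext a (fun h => (hfro bo hbo h).1) (hmov bo hbo)
  · rw [mwordEval_map_bondMLetter, hG c hc0 hc1]

end Generic

/-! ## §2 The cell's indexing: oriented boundary bonds of a plaquette; END-II's binders from block bond data -/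

section Cell

variable {P : Params} {j : ℕ}

/-- THE FOUR ORIENTED BOUNDARY BONDS of `p = ⟨x; μ < ν⟩`, in the order and with the inversions of
`Setup.GaugeField.plaqHol`: `(⟨x, μ⟩, +)`, `(⟨x+e_μ, ν⟩, +)`, `(⟨x+e_ν, μ⟩, −)`, `(⟨x, ν⟩, −)` (`true` = reversed).
[folklore] -/
def plaqOBonds (p : Plaq P j) : List (PBond P j × Bool) :=
  [(⟨p.src, p.μ⟩, false), (⟨p.src.shift p.μ, p.ν⟩, false), (⟨p.src.shift p.ν, p.μ⟩, true), (⟨p.src, p.ν⟩, true)]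

/-- four bonds. [folklore] -/
@[simp] theorem length_plaqOBonds (p : Plaq P j) : (plaqOBonds p).length = 4 := rfl

/-- the product over the oriented boundary bonds is the four-factor product. [folklore] -/
theorem prod_map_plaqOBonds {M : Type*} [Monoid M] (F : PBond P j × Bool → M) (p : Plaq P j) :
    ((plaqOBonds p).map F).prod = F (⟨p.src, p.μ⟩, false) * F (⟨p.src.shift p.μ, p.ν⟩, false) *
      F (⟨p.src.shift p.ν, p.μ⟩, true) * F (⟨p.src, p.ν⟩, true) := by
  simp [plaqOBonds, mul_assoc]

/-- DICTIONARY with `Setup`: the plaquette variable `U(∂p)` of ANY configuration is the product over `plaqOBonds p` of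
`U b` ∕ `(U b)⁻¹` according to the orientation. [folklore] -/
theorem plaqHol_eq_prod_plaqOBonds {G : Type*} [GaugeGroup G] (U : GaugeField P j G) (p : Plaq P j) :
    GaugeField.plaqHol U p = ((plaqOBonds p).map fun bo => if bo.2 then (U bo.1)⁻¹ else U bo.1).prod := by
  rw [prod_map_plaqOBonds]
  rfl

variable {A : Type*} [NormedRing A] [NormedAlgebra ℂ A] [CompleteSpace A]
variable {E : Type*} [AddCommGroup E] [Module ℝ E]

/-- **SM-L1 WIRED: END-II's `hAN` FROM BLOCK BOND DATA.**  Classifier plaquettes `P_u` with their boundary bonds in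
the block's bond set `Λu`; ONE bond family `X x b` per window point with (an) `(R, a)` and (fl) for every `b ∈ Λu`; the
classifier's plaquette functional along the ray = the plaquette word of the signed exponentials ⇒ the binder `hAN` of
`slotAntiConcentration_of_levelData` ∕ END-II with `H = e^{4a} − 1`. [folklore] -/
theorem hAN_of_blockBondData {W : Set E} {Pu : Finset (Plaq P j)} {Λu : Finset (PBond P j)}
    (hcov : ∀ p ∈ Pu, ∀ bo ∈ plaqOBonds p, bo.1 ∈ Λu) (hol : Plaq P j → E → A) (X : E → PBond P j → ℂ → A)
    {R a : ℝ} (hX : ∀ x ∈ W, ∀ b ∈ Λu,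
      DifferentiableOn ℂ (X x b) (ball 0 R) ∧ (∀ w ∈ ball (0 : ℂ) R, ‖X x b w‖ ≤ a) ∧ X x b 0 = 0)
    (hhol : ∀ x ∈ W, ∀ p ∈ Pu, ∀ c : ℝ, 0 ≤ c → c ≤ 1 →
      hol p (c • x) = exp (X x ⟨p.src, p.μ⟩ c) * exp (X x ⟨p.src.shift p.μ, p.ν⟩ c) *
        exp (-(X x ⟨p.src.shift p.ν, p.μ⟩ c)) * exp (-(X x ⟨p.src, p.ν⟩ c))) :
    ∀ x ∈ W, ∀ p ∈ Pu, ∃ f : ℂ → A, DifferentiableOn ℂ f (ball 0 R) ∧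
      (∀ w ∈ ball (0 : ℂ) R, ‖f w‖ ≤ Real.exp (4 * a) - 1) ∧ f 0 = 0 ∧
      ∀ c : ℝ, 0 ≤ c → c ≤ 1 → f (c : ℂ) = hol p (c • x) - 1 := by
  intro x hx p hp
  have hhol' : ∀ c : ℝ, 0 ≤ c → c ≤ 1 →
      hol p (c • x) = ((plaqOBonds p).map fun bo => exp (osgn bo.2 (X x bo.1 c))).prod := fun c hc0 hc1 => by
    rw [hhol x hx p hp c hc0 hc1, prod_map_plaqOBonds]; rfl
  obtain ⟨f, hf, hH, hf0, hfc⟩ := classifierWitness_of_orientedBondData (plaqOBonds p) (X x) (R := R) (a := a)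
    (hol := fun c : ℝ => hol p (c • x)) (fun bo hbo => hX x hx bo.1 (hcov p hp bo hbo)) hhol'
  exact ⟨f, hf, by simpa only [length_plaqOBonds, Nat.cast_ofNat] using hH, hf0, hfc⟩

variable [DecidableEq (PBond P j)]

/-- **SM-L3 WIRED: END-II's `hGW` FROM BLOCK BOND DATA.**  Weight plaquettes `P_w` (the Wilson part meeting the
block); moving bonds `Λ` (the chart's block bonds) with ONE bond family `X x b` per window point carrying (an)
`(R, a_b)` and (sk); frozen exterior letters `ext b o` (contractions, deviation `≤ d_b`); the weight's plaquette word
along the ray = the product of the bond factors ⇒ the binder `hGW` of `slotAntiConcentration_of_levelData` ∕ END-II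
with `s̄_p = Σ_{∂p, moving} a_b`, `L̄_p = Σ_{∂p, moving} 3a_b/(R−1)`, `d̄_p = Σ_{∂p, frozen} d_b`. [folklore] -/
theorem hGW_of_blockBondData (T : TraceData A) {R : ℝ} (hR : 1 < R) {W : Set E} {Pw : Finset (Plaq P j)}
    (Λ : Finset (PBond P j)) (G : Plaq P j → E → A) (X : E → PBond P j → ℂ → A) (ext : PBond P j → Bool → A)
    (a d : PBond P j → ℝ)
    (hX : ∀ x ∈ W, ∀ b ∈ Λ, DifferentiableOn ℂ (X x b) (ball 0 R) ∧ (∀ w ∈ ball (0 : ℂ) R, ‖X x b w‖ ≤ a b) ∧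
      ∀ c : ℝ, 0 ≤ c → c ≤ 1 → T.τ (X x b c) = 0 ∧ ‖exp (X x b c)‖ ≤ 1 ∧ ‖exp (-(X x b c))‖ ≤ 1)
    (hext : ∀ p ∈ Pw, ∀ bo ∈ plaqOBonds p, bo.1 ∉ Λ → ‖ext bo.1 bo.2‖ ≤ 1 ∧ ‖ext bo.1 bo.2 - 1‖ ≤ d bo.1)
    (hG : ∀ x ∈ W, ∀ p ∈ Pw, ∀ c : ℝ, 0 ≤ c → c ≤ 1 →
      G p (c • x) = bondFactor Λ (X x) ext c (⟨p.src, p.μ⟩, false) *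
        bondFactor Λ (X x) ext c (⟨p.src.shift p.μ, p.ν⟩, false) *
        bondFactor Λ (X x) ext c (⟨p.src.shift p.ν, p.μ⟩, true) * bondFactor Λ (X x) ext c (⟨p.src, p.ν⟩, true)) :
    ∀ x ∈ W, ∀ p ∈ Pw, ∃ gw : List (MLetter A × ℝ × ℝ), (∀ y ∈ gw, y.1.Good T.τ y.2.1 y.2.2) ∧
      sSum gw ≤ movingSize Λ a (plaqOBonds p) ∧
      lSum gw ≤ movingSize Λ (fun b => 3 * a b / (R - 1)) (plaqOBonds p) ∧
      mdFro (gw.map Prod.fst) ≤ frozenSize Λ d (plaqOBonds p) ∧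
      ∀ c : ℝ, 0 ≤ c → c ≤ 1 → mwordEval c (gw.map Prod.fst) = G p (c • x) := by
  intro x hx p hp
  exact weightWord_of_orientedBondData T hR Λ (X x) ext a d (plaqOBonds p) (G := fun c : ℝ => G p (c • x))
    (fun bo _ hb => hX x hx bo.1 hb) (fun bo hbo hb => hext p hp bo hbo hb) fun c hc0 hc1 => by
      show G p (c • x) = _
      rw [hG x hx p hp c hc0 hc1, prod_map_plaqOBonds]

end Cell

/-! ## §3 END-II from block bond data (`G = SU(2)`, realized) -/

section EndTwo

variable {P : Params} {j : ℕ} [DecidableEq (PBond P j)]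
variable {A : Type*} [NormedRing A] [NormedAlgebra ℂ A] [CompleteSpace A] [NormOneClass A]

/-- **END-II ⇐ PER-BOND BINDERS (SM-L1 ∕ SM-L3 wired) + SM-L2 ∕ L4 ∕ L5–L6 + DICTIONARY, PER SLOT (`G = SU(2)`).**
`slotAC_realized_su2_of_levelData` with `hAN` ∕ `hGW` REPLACED by: per exterior section `V` and window point `x ∈ W V`
ONE bond family `X V x : PBond → (ℂ → A)` carrying, for every bond of the classifier set `Λu` and of the chart `Λ`, the
analyticity–boundedness pair `(Rad, a_b)` (`a_b ≤ ā` on `Λu`), the flat centre on `Λu`, the skew-Hermitian TYPE on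
`Λ`; frozen exterior letters `ext V b o` (contractions, deviation `≤ d_b`); the two plaquette DICTIONARIES.  The
constants `Rad, ā, a_b, d_b` carry no `V`, no `x`: «one pair per bond of the block, uniform».  CONCLUSION:
`SlotAntiConcentration ((fieldMeasure P j SU2).withDensity F) u θ ρ (2(n + β Σ_p L̄_p(d̄_p + 4 s̄_p) + B_𝓔)/(1−δ))`,
`H = e^{4ā} − 1` in (SM).  CONDITIONAL on every binder; nothing PRINTED is asserted; NE7c NOT proved. [folklore] -/
theorem slotAC_realized_su2_of_blockBondData {T : Finset (PBond P j)} (hT : NoClosedLoop T)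
    (U₀ : GaugeField P j SU2) (Λ : Finset (PBond P j)) {n : ℕ} (e : ↥Λ × Fin 3 ≃ Fin n)
    {S : ℝ} (hS : 0 < S) (hSπ : 3 * S ^ 2 < Real.pi ^ 2) (c : GaugeField P j SU2 → GaugeField P j SU2)
    {R : GaugeField P j SU2 → (↥Λ → SU2) → ℝ≥0∞} (hR : ∀ V, Measurable (R V))
    {F : GaugeField P j SU2 → ℝ≥0∞} (hF : Measurable F) (hFi : GaugeInvariant F)
    (hFw : ∀ V y, F (fixTo T U₀ (updateFinset V Λ y)) =
      ENNReal.ofReal (expWindowDensity Λ (c V) S (updateFinset (c V) Λ y)) * R V y)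
    (hfin : ∀ V, ((blockLaw Λ).withDensity fun y => F (fixTo T U₀ (updateFinset V Λ y))) univ ≠ ∞)
    {u : GaugeField P j SU2 → ℝ} (hu : Measurable u) (hui : GaugeInvariant u)  -- level data per exterior section:
    (Ttr : TraceData A) (hN : 0 < Ttr.N) {Pu : Finset (Plaq P j)} (hPu : Pu.Nonempty)
    (hol : GaugeField P j SU2 → Plaq P j → (Fin n → ℝ) → A) (hcont : ∀ V, ∀ p ∈ Pu, Continuous (hol V p))
    (Pw : Finset (Plaq P j)) (G : GaugeField P j SU2 → Plaq P j → (Fin n → ℝ) → A) (𝓔 : GaugeField P j SU2 → (Fin n → ℝ) → ℝ)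
    (W : GaugeField P j SU2 → Set (Fin n → ℝ)) (Jco : GaugeField P j SU2 → (Fin n → ℝ) → ℝ≥0∞)
    {θ δ ρ β Rad ā B𝓔 : ℝ}  -- DICTIONARY (block weight, classifier); SM-L5/L6 kept co-tests (window, centre-monotone):
    (hRdict : ∀ V x, R V (expFibreChart Λ (c V) e x) = Jco V x * weight Ttr β Pw (G V) (𝓔 V) x)
    (hudict : ∀ V x, u (fixTo T U₀ (updateFinset V Λ (expFibreChart Λ (c V) e x))) = classifier hPu (hol V) x)
    (hJW : ∀ V x, Jco V x ≠ 0 → x ∈ W V)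
    (hJ : ∀ V x, ∀ a : ℝ, 0 ≤ a → Jco V x ≤ Jco V (Real.exp (-a) • x))
    -- THE BLOCK BOND DATA: ONE bond family per (V, x); classifier bonds Λu, moving bonds Λ, frozen exterior letters
    (Λu : Finset (PBond P j)) (hcov : ∀ p ∈ Pu, ∀ bo ∈ plaqOBonds p, bo.1 ∈ Λu)
    (X : GaugeField P j SU2 → (Fin n → ℝ) → PBond P j → ℂ → A)
    (ext : GaugeField P j SU2 → PBond P j → Bool → A) (a d : PBond P j → ℝ) (ha0 : ∀ b, 0 ≤ a b)
    (hd0 : ∀ b, 0 ≤ d b) (hRad : 1 < Rad)  -- SM-L1 per bond: (an) + (fl) on the classifier bonds, `a_b ≤ ā`: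
    (hXu : ∀ V, ∀ x ∈ W V, ∀ b ∈ Λu, DifferentiableOn ℂ (X V x b) (ball 0 Rad) ∧
      (∀ w ∈ ball (0 : ℂ) Rad, ‖X V x b w‖ ≤ a b) ∧ X V x b 0 = 0)
    (hā : ∀ b ∈ Λu, a b ≤ ā)  -- SM-L3 per bond: (an) + (sk) on the moving bonds; frozen exterior letters:
    (hXw : ∀ V, ∀ x ∈ W V, ∀ b ∈ Λ, DifferentiableOn ℂ (X V x b) (ball 0 Rad) ∧
      (∀ w ∈ ball (0 : ℂ) Rad, ‖X V x b w‖ ≤ a b) ∧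
      ∀ c' : ℝ, 0 ≤ c' → c' ≤ 1 → Ttr.τ (X V x b c') = 0 ∧ ‖exp (X V x b c')‖ ≤ 1 ∧ ‖exp (-(X V x b c'))‖ ≤ 1)
    (hext : ∀ V, ∀ p ∈ Pw, ∀ bo ∈ plaqOBonds p, bo.1 ∉ Λ →
      ‖ext V bo.1 bo.2‖ ≤ 1 ∧ ‖ext V bo.1 bo.2 - 1‖ ≤ d bo.1)  -- the two plaquette dictionaries along the ray:
    (hhol : ∀ V, ∀ x ∈ W V, ∀ p ∈ Pu, ∀ c' : ℝ, 0 ≤ c' → c' ≤ 1 →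
      hol V p (c' • x) = exp (X V x ⟨p.src, p.μ⟩ c') * exp (X V x ⟨p.src.shift p.μ, p.ν⟩ c') *
        exp (-(X V x ⟨p.src.shift p.ν, p.μ⟩ c')) * exp (-(X V x ⟨p.src, p.ν⟩ c')))
    (hG : ∀ V, ∀ x ∈ W V, ∀ p ∈ Pw, ∀ c' : ℝ, 0 ≤ c' → c' ≤ 1 →
      G V p (c' • x) = bondFactor Λ (X V x) (ext V) c' (⟨p.src, p.μ⟩, false) *
        bondFactor Λ (X V x) (ext V) c' (⟨p.src.shift p.μ, p.ν⟩, false) *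
        bondFactor Λ (X V x) (ext V) c' (⟨p.src.shift p.ν, p.μ⟩, true) *
        bondFactor Λ (X V x) (ext V) c' (⟨p.src, p.ν⟩, true))
    (hs1 : ∀ p ∈ Pw, movingSize Λ a (plaqOBonds p) ≤ 1)  -- `s̄_p ≤ 1`; then SM-L4, numbers, SM-L2 (`H = e^{4ā} − 1`):
    (hE : ∀ V, ∀ x ∈ W V, ∀ c' : ℝ, 1 / 2 ≤ c' → c' ≤ 1 → 𝓔 V (c' • x) ≤ 𝓔 V x + (1 - c') * B𝓔) (hB𝓔 : 0 ≤ B𝓔)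
    (hθ : 0 < θ) (hδ0 : 0 ≤ δ) (hδ1 : δ < 1) (hρ0 : 0 ≤ ρ) (hρ : ρ ≤ (1 - δ) / 2) (hβ : 0 ≤ β)
    (hSM : 36 * (Real.exp (4 * ā) - 1) * 1 ^ 2 / (Rad - 1) ^ 2 ≤ δ * θ) :
    SlotAntiConcentration ((fieldMeasure P j SU2).withDensity F) u θ ρ
      (2 * ((n : ℝ) + (β * ∑ p ∈ Pw, movingSize Λ (fun b => 3 * a b / (Rad - 1)) (plaqOBonds p) *
        (frozenSize Λ d (plaqOBonds p) + 4 * movingSize Λ a (plaqOBonds p)) + B𝓔)) / (1 - δ)) := by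
  have hL0 : ∀ b, 0 ≤ 3 * a b / (Rad - 1) := fun b => div_nonneg (by linarith [ha0 b]) (by linarith)
  exact slotAC_realized_su2_of_levelData hT U₀ Λ e hS hSπ c hR hF hFi hFw hfin hu hui Ttr hN hPu hol hcont Pw G 𝓔
    W Jco hRdict hudict hJW hJ hRad
    (fun V => hAN_of_blockBondData (hcov := hcov) (hol V) (X V) (R := Rad) (a := ā)
      (fun x hx b hb => ⟨(hXu V x hx b hb).1, fun w hw => ((hXu V x hx b hb).2.1 w hw).trans (hā b hb),
        (hXu V x hx b hb).2.2⟩) (hhol V))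
    (fun V => hGW_of_blockBondData Ttr hRad Λ (G V) (X V) (ext V) a d (hXw V) (hext V) (hG V))
    hs1 (fun p _ => (sizes_nonneg Λ ha0 hd0 _).1) (fun p _ => (sizes_nonneg Λ hL0 hd0 _).1)
    (fun p _ => (sizes_nonneg Λ ha0 hd0 _).2) hE hB𝓔 hθ hδ0 hδ1 hρ0 hρ hβ hSM

end EndTwo

end Summit.QuantumFields.BalabanUV.T4Continuum.ShellMeasureBlockWiring
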